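import Summits.AtomisticToContinuum.FouriersLaw.Theorems.EmbeddedDrudeMourreNessUniqueDuhamel
import Literature.MathematicalPhysics.KineticTheory.LangevinChainDynkin

/-!
# The Gibbs weight at `T` as an approximate steady state at `(T+δ/2, T-δ/2)`: the defect
(stub S2b `stub_nessFlipAsymmetryLipschitz`, line `fekete-usc-one-length`, brick 2)

`--supports stmt-AtomisticToContinuum-11976` helper file (crux `VanishingNoiseBound`, route
`VanishingNoiseTransfer`). For the pinned chain `pinnedChain ω₂ lam β γ` (`ω₂ > 0`, `lam, β, γ ≥ 0`,
`N ≥ 1`) with baths at `(T_L, T_R) = (T+δ/2, T-δ/2)`, the Gibbs weight `ρ = e^{-H/T}` at the MEAN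
temperature has the explicit stationary defect `L̂ρ + 2γρ = (γδ/2T²)(p_0² - p_{N-1}²) ρ` (`L̂` the
generator of the time-reversed Langevin equation, `Lᵀ = L̂ + 2γ` the Lebesgue transpose of the
generator): it solves the stationary Fokker–Planck equation up to `O(δ)`. This file:

* `revGenerator_truncGibbs_defect_le` — pointwise defect of the `C²_c` truncations
  `ρ_R = e^{-H/T} χ(H/R)`: `|L̂ρ_R + 2γρ_R| ≤ (γ|δ|/(2T²) + κ/R)(1 + p_0² + p_{N-1}²) e^{-H/T}`
  (`revGenerator_comp_hamiltonian`; the `χ', χ''` terms carry `1/R`);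
* `pinnedChain_lintegral_exp_mul_revKernel_le` — the weighted slice bound
  `∫ e^{ϑH}(y) P̂_s φ(y) dy ≤ e^{ϑγ(T_L+T_R)s} ∫ φ e^{ϑH} dx` for the reversed kernels `P̂_s`
  (Lebesgue duality `dx P_s(x,dy) = e^{2γs} dy P̂_s(y,dx)` + CEHR (3.4)), and two bookkeeping
  consequences of (3.4) for the forward kernels (`…integrable_transitionKernel_of_abs_le_exp`,
  `…abs_integral_transitionKernel_le`).

The weighted Duhamel bound, the almost-invariance estimate (E) and the assembly of the stub from
temperature-uniform exponential convergence are in the sequel files. No definitions.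
-/

noncomputable section

namespace Summit.AtomisticToContinuum.FouriersLaw.Theorems.FixedLengthNoiseContinuity

open MeasureTheory ProbabilityTheory Filter Topology Set
open scoped NNReal ENNReal ContDiff
open Literature.MathematicalPhysics.KineticTheory.HeatConduction
open Literature.MathematicalPhysics.KineticTheory Literature.Probability.Process OscillatorChain
open Summit.AtomisticToContinuum.FouriersLaw.Theorems.SubdiffusiveBondHeat
open Summit.AtomisticToContinuum.FouriersLaw.Theorems.NessUnique

variable {N : ℕ}

/-! ## §1 The stationary defect of the truncated Gibbs weight at unequal bath temperatures -/

section Defect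

variable {P : OscillatorChain}

/-- **Defect of the truncated Gibbs weight at bath temperatures `(T+δ/2, T-δ/2)`.** For confining
`C²` potentials, `N ≥ 1`, `γ ≥ 0`, `T > 0` there is `κ ≥ 0` such that for all
`|δ| ≤ 2T`, `R ≥ 1` and `x`, with `ρ_R = e^{-H/T}χ(H/R)` and `S = p_0² + p_{N-1}²`:
`|L̂_{T+δ/2,T-δ/2} ρ_R(x) + 2γ ρ_R(x)| ≤ (γ|δ|/(2T²) + κ/R)(1 + S(x)) e^{-H(x)/T}`. The `χ(H/R)`-term
of `L̂ρ_R + 2γρ_R` is EXACTLY `(γδ/2T²) e^{-H/T}χ(H/R)(p_0² - p_{N-1}²)` (`revGenerator_comp_hamiltonian`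
with `T_L + T_R = 2T`); the `χ', χ''` terms carry factors `1/R`, `1/R²`. [folklore] -/
theorem revGenerator_truncGibbs_defect_le (hU : ContDiff ℝ 2 P.U) (hV : ContDiff ℝ 2 P.V)
    (hN : 0 < N) (hγ : 0 ≤ P.γ) {T : ℝ} (hT : 0 < T) :
    ∃ κ : ℝ, 0 ≤ κ ∧ ∀ δ : ℝ, |δ| ≤ 2 * T → ∀ R : ℝ, 1 ≤ R → ∀ x : PhaseSpace N,
      |sdeGenerator (fun y => -P.drift N y) (P.bathVecL N (T + δ / 2)) (P.bathVecR N (T - δ / 2))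
          (fun y => Real.exp (-P.hamiltonian N y / T) * smoothCutoff (P.hamiltonian N y / R)) x +
        2 * P.γ * (Real.exp (-P.hamiltonian N x / T) * smoothCutoff (P.hamiltonian N x / R))| ≤
      (P.γ * |δ| / (2 * T ^ 2) + κ / R) *
        (1 + (x.2 ⟨0, hN⟩ ^ 2 + x.2 ⟨N - 1, Nat.sub_lt hN one_pos⟩ ^ 2)) *
          Real.exp (-P.hamiltonian N x / T) := by
  obtain ⟨M₁, hM₁0, hM₁⟩ := exists_bound_deriv_smoothCutoff
  obtain ⟨M₂, hM₂0, hM₂⟩ := exists_bound_deriv_deriv_smoothCutoff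
  refine ⟨P.γ * (2 * T * M₁ + 5 * M₁ + 2 * T * M₂), by positivity, fun δ hδ R hR x => ?_⟩
  have hR0 : 0 < R := lt_of_lt_of_le one_pos hR
  have hTL0 : 0 ≤ T + δ / 2 := by cases abs_le.1 hδ; linarith
  have hTR0 : 0 ≤ T - δ / 2 := by cases abs_le.1 hδ; linarith
  have hTL2 : T + δ / 2 ≤ 2 * T := by cases abs_le.1 hδ; linarith
  have hTR2 : T - δ / 2 ≤ 2 * T := by cases abs_le.1 hδ; linarith
  have hL : 0 ≤ P.γ * (T + δ / 2) := mul_nonneg hγ hTL0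
  have hR' : 0 ≤ P.γ * (T - δ / 2) := mul_nonneg hγ hTR0
  have hT0 : T ≠ 0 := hT.ne'
  have hR0' : R ≠ 0 := hR0.ne'
  have h := revGenerator_comp_hamiltonian hU hV hN hL hR' (hasDerivAt_truncProfile T R)
    (hasDerivAt_deriv_truncProfile hT.ne' hR0.ne') x
  rw [h]
  -- notation
  set Hx := P.hamiltonian N x with hHx
  set E := Real.exp (-Hx / T) with hE
  set χ₀ := smoothCutoff (Hx / R)
  set χ₁ := deriv smoothCutoff (Hx / R)
  set χ₂ := deriv (deriv smoothCutoff) (Hx / R)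
  set A := x.2 ⟨0, hN⟩ ^ 2 with hA
  set B := x.2 ⟨N - 1, Nat.sub_lt hN one_pos⟩ ^ 2 with hB
  have hA0 : 0 ≤ A := sq_nonneg _
  have hB0 : 0 ≤ B := sq_nonneg _
  have hE0 : 0 < E := Real.exp_pos _
  have hχ₀0 : 0 ≤ χ₀ := smoothCutoff_nonneg _
  have hχ₀1 : χ₀ ≤ 1 := smoothCutoff_le_one _
  -- the algebraic identity: `χ₀`-term `(γδ/2T²) E χ₀ (A - B)` + `1/R`-terms
  have key : P.γ * ((-(1 / T) * (E * χ₀) + E * χ₁ / R) * (T + δ / 2 + (T - δ / 2) + A + B) +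
      (1 / T ^ 2 * (E * χ₀) - 2 / (T * R) * (E * χ₁) + E * χ₂ / R ^ 2) *
        ((T + δ / 2) * A + (T - δ / 2) * B)) + 2 * P.γ * (E * χ₀) =
      P.γ * δ / (2 * T ^ 2) * (E * χ₀ * (A - B)) +
        P.γ / R * (E * (χ₁ * (2 * T + A + B) - 2 / T * χ₁ * ((T + δ / 2) * A + (T - δ / 2) * B) +
          χ₂ * ((T + δ / 2) * A + (T - δ / 2) * B) / R)) := by
    field_simp; ring
  rw [key]
  -- bound the two pieces
  have hW : (T + δ / 2) * A + (T - δ / 2) * B ≤ 2 * T * (A + B) := by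
    calc (T + δ / 2) * A + (T - δ / 2) * B ≤ 2 * T * A + 2 * T * B :=
          add_le_add (mul_le_mul_of_nonneg_right hTL2 hA0) (mul_le_mul_of_nonneg_right hTR2 hB0)
      _ = 2 * T * (A + B) := by ring
  have hW0 : 0 ≤ (T + δ / 2) * A + (T - δ / 2) * B := by positivity
  have t1 : |P.γ * δ / (2 * T ^ 2) * (E * χ₀ * (A - B))| ≤ P.γ * |δ| / (2 * T ^ 2) * ((1 + (A + B)) * E) := by
    rw [abs_mul, abs_div, abs_mul, abs_of_nonneg hγ, abs_of_pos (by positivity : (0:ℝ) < 2 * T ^ 2)]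
    refine mul_le_mul_of_nonneg_left ?_ (by positivity)
    rw [abs_mul, abs_mul, abs_of_pos hE0, abs_of_nonneg hχ₀0]
    have hAB : |A - B| ≤ A + B := by rw [abs_le]; constructor <;> linarith
    calc E * χ₀ * |A - B| ≤ E * 1 * (A + B) := by
          apply mul_le_mul (mul_le_mul_of_nonneg_left hχ₀1 hE0.le) hAB (abs_nonneg _) (by positivity)
      _ ≤ E * 1 * (A + B) + E := le_add_of_nonneg_right hE0.le
      _ = (1 + (A + B)) * E := by ring
  have t2 : |P.γ / R * (E * (χ₁ * (2 * T + A + B) - 2 / T * χ₁ * ((T + δ / 2) * A + (T - δ / 2) * B) +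
      χ₂ * ((T + δ / 2) * A + (T - δ / 2) * B) / R))| ≤
      P.γ * (2 * T * M₁ + 5 * M₁ + 2 * T * M₂) / R * ((1 + (A + B)) * E) := by
    rw [abs_mul, abs_div, abs_of_nonneg hγ, abs_of_pos hR0, abs_mul, abs_of_pos hE0]
    have hχ₁ := hM₁ (Hx / R)
    have hχ₂ := hM₂ (Hx / R)
    have s1 : |χ₁ * (2 * T + A + B)| ≤ M₁ * (2 * T + (A + B)) := by
      rw [abs_mul, abs_of_nonneg (by positivity : 0 ≤ 2 * T + A + B), ← add_assoc]
      exact mul_le_mul_of_nonneg_right hχ₁ (by positivity)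
    have s2 : |2 / T * χ₁ * ((T + δ / 2) * A + (T - δ / 2) * B)| ≤ 4 * M₁ * (A + B) := by
      rw [abs_mul, abs_mul, abs_of_pos (by positivity : (0:ℝ) < 2 / T), abs_of_nonneg hW0]
      calc 2 / T * |χ₁| * ((T + δ / 2) * A + (T - δ / 2) * B) ≤ 2 / T * M₁ * (2 * T * (A + B)) := by
            apply mul_le_mul (mul_le_mul_of_nonneg_left hχ₁ (by positivity)) hW hW0 (by positivity)
        _ = 4 * M₁ * (A + B) := by field_simp; ring
    have s3 : |χ₂ * ((T + δ / 2) * A + (T - δ / 2) * B) / R| ≤ 2 * T * M₂ * (A + B) := by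
      rw [abs_div, abs_mul, abs_of_pos hR0, abs_of_nonneg hW0]
      calc |χ₂| * ((T + δ / 2) * A + (T - δ / 2) * B) / R ≤ |χ₂| * ((T + δ / 2) * A + (T - δ / 2) * B) / 1 :=
            div_le_div_of_nonneg_left (by positivity) one_pos hR
        _ ≤ M₂ * (2 * T * (A + B)) := by
            rw [div_one]; exact mul_le_mul hχ₂ hW hW0 hM₂0
        _ = 2 * T * M₂ * (A + B) := by ring
    have s : |χ₁ * (2 * T + A + B) - 2 / T * χ₁ * ((T + δ / 2) * A + (T - δ / 2) * B) +
        χ₂ * ((T + δ / 2) * A + (T - δ / 2) * B) / R| ≤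
        (2 * T * M₁ + 5 * M₁ + 2 * T * M₂) * (1 + (A + B)) := by
      calc _ ≤ |χ₁ * (2 * T + A + B) - 2 / T * χ₁ * ((T + δ / 2) * A + (T - δ / 2) * B)| +
            |χ₂ * ((T + δ / 2) * A + (T - δ / 2) * B) / R| := abs_add_le _ _
        _ ≤ (|χ₁ * (2 * T + A + B)| + |2 / T * χ₁ * ((T + δ / 2) * A + (T - δ / 2) * B)|) +
            |χ₂ * ((T + δ / 2) * A + (T - δ / 2) * B) / R| := by
              gcongr; exact abs_sub _ _
        _ ≤ (M₁ * (2 * T + (A + B)) + 4 * M₁ * (A + B)) + 2 * T * M₂ * (A + B) :=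
            add_le_add (add_le_add s1 s2) s3
        _ ≤ (M₁ * (2 * T + (A + B)) + 4 * M₁ * (A + B)) + 2 * T * M₂ * (A + B) +
            (2 * T * M₁ * (A + B) + 5 * M₁ + 2 * T * M₂) := le_add_of_nonneg_right (by positivity)
        _ = (2 * T * M₁ + 5 * M₁ + 2 * T * M₂) * (1 + (A + B)) := by ring
    calc P.γ / R * (E * |χ₁ * (2 * T + A + B) - 2 / T * χ₁ * ((T + δ / 2) * A + (T - δ / 2) * B) +
          χ₂ * ((T + δ / 2) * A + (T - δ / 2) * B) / R|)
        ≤ P.γ / R * (E * ((2 * T * M₁ + 5 * M₁ + 2 * T * M₂) * (1 + (A + B)))) :=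
          mul_le_mul_of_nonneg_left (mul_le_mul_of_nonneg_left s hE0.le) (by positivity)
      _ = P.γ * (2 * T * M₁ + 5 * M₁ + 2 * T * M₂) / R * ((1 + (A + B)) * E) := by ring
  calc _ ≤ |P.γ * δ / (2 * T ^ 2) * (E * χ₀ * (A - B))| +
        |P.γ / R * (E * (χ₁ * (2 * T + A + B) - 2 / T * χ₁ * ((T + δ / 2) * A + (T - δ / 2) * B) +
          χ₂ * ((T + δ / 2) * A + (T - δ / 2) * B) / R))| := abs_add_le _ _
    _ ≤ P.γ * |δ| / (2 * T ^ 2) * ((1 + (A + B)) * E) +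
        P.γ * (2 * T * M₁ + 5 * M₁ + 2 * T * M₂) / R * ((1 + (A + B)) * E) := add_le_add t1 t2
    _ = (P.γ * |δ| / (2 * T ^ 2) + P.γ * (2 * T * M₁ + 5 * M₁ + 2 * T * M₂) / R) *
        (1 + (A + B)) * E := by ring

end Defect

/-! ## §2 The weighted Duhamel bound for the pinned chain -/

section Duhamel

variable {ω₂ lam β γ : ℝ} (hω : 0 < ω₂) (hl : 0 ≤ lam) (hβ : 0 ≤ β) (hγ : 0 ≤ γ) (hN : 0 < N)
  {T_L T_R : ℝ} (hTL : 0 < T_L) (hTR : 0 < T_R) {ϑ : ℝ} (hϑ : 0 < ϑ) (hϑ' : ϑ < 1 / max T_L T_R)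
include hω hl hβ hγ hN hTL hTR hϑ hϑ'

/-- **Weighted slice bound.** For measurable `φ ≥ 0`, `s > 0` and the reversed kernels `P̂_s` of
the pinned chain: `∫ e^{ϑH(y)} (∫ φ dP̂_s(y,·)) dy ≤ e^{ϑγ(T_L+T_R)s} ∫ φ e^{ϑH} dx` — Lebesgue
duality `dx P_s(x,dy) = e^{2γs} dy P̂_s(y,dx)` (`e^{2γs} ≥ 1`) and CEHR (3.4)
`∫ e^{ϑH} dP_s(x,·) ≤ e^{ϑγ(T_L+T_R)s} e^{ϑH(x)}`. [folklore] -/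
theorem pinnedChain_lintegral_exp_mul_revKernel_le {s : ℝ≥0} (hs : 0 < s) {φ : PhaseSpace N → ℝ≥0∞}
    (hφ : Measurable φ) :
    ∫⁻ y, ENNReal.ofReal (Real.exp (ϑ * (pinnedChain ω₂ lam β γ).hamiltonian N y)) *
        ∫⁻ x, φ x ∂((pinnedChain ω₂ lam β γ).langevinRevKernel N T_L T_R s y) ≤
      ENNReal.ofReal (Real.exp (ϑ * γ * (T_L + T_R) * s)) *
        ∫⁻ x, φ x * ENNReal.ofReal (Real.exp (ϑ * (pinnedChain ω₂ lam β γ).hamiltonian N x)) := by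
  set P := pinnedChain ω₂ lam β γ with hPdef
  have hP : P.IsConfining := pinnedChain_isConfining hω hl hβ hγ
  set V : PhaseSpace N → ℝ≥0∞ := fun y => ENNReal.ofReal (Real.exp (ϑ * P.hamiltonian N y)) with hVdef
  have hVm : Measurable V :=
    (Real.continuous_exp.comp (continuous_const.mul (pinnedChain_continuous_hamiltonian ω₂ lam β γ N))).measurable.ennreal_ofReal
  set Hf : PhaseSpace N × PhaseSpace N → ℝ≥0∞ := fun p => φ p.1 * V p.2 with hHf
  have hHm : Measurable Hf := (hφ.comp measurable_fst).mul (hVm.comp measurable_snd)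
  have hdual := hP.lintegral_langevinKernel_duality (T_L := T_L) (T_R := T_R)
    (pinnedChain_contDiff_U ω₂ lam β γ) (pinnedChain_contDiff_V ω₂ lam β γ) hN hs hHm
  -- left side of the duality, bounded through (3.4)
  have hK : P.langevinKernel N T_L T_R s = P.transitionKernel N T_L T_R s :=
    pinnedChain_langevinKernel_eq_transitionKernel N T_L T_R hω hl hβ hγ s
  have hL : ∫⁻ x, ∫⁻ y, Hf (x, y) ∂(P.langevinKernel N T_L T_R s x) ≤
      ENNReal.ofReal (Real.exp (ϑ * γ * (T_L + T_R) * s)) * ∫⁻ x, φ x * V x := by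
    rw [← lintegral_const_mul' _ _ ENNReal.ofReal_ne_top]
    refine lintegral_mono fun x => ?_
    simp only [hHf]
    rw [lintegral_const_mul _ hVm, hK, ← mul_assoc, mul_comm (ENNReal.ofReal _) (φ x), mul_assoc]
    have h34 := lintegral_exp_mul_hamiltonian_pinnedChainSemigroup_le hω hl hβ hγ hN hTL.le hTR.le hTL
      hTR hϑ hϑ' s x
    rw [ENNReal.ofReal_mul (Real.exp_pos _).le] at h34
    gcongr
  -- right side of the duality is the weighted slice, and `e^{2γs} ≥ 1`
  have hR : ∀ y, ∫⁻ x, Hf (x, y) ∂(P.langevinRevKernel N T_L T_R s y) =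
      V y * ∫⁻ x, φ x ∂(P.langevinRevKernel N T_L T_R s y) := fun y => by
    simp only [hHf]
    rw [lintegral_mul_const _ hφ, mul_comm]
  simp_rw [hR] at hdual
  have h1 : (1 : ℝ≥0∞) ≤ ENNReal.ofReal (Real.exp (2 * P.γ * s)) := by
    rw [← ENNReal.ofReal_one]
    exact ENNReal.ofReal_le_ofReal (Real.one_le_exp (by
      have := hP.γ_nonneg; have := s.coe_nonneg; positivity))
  calc ∫⁻ y, V y * ∫⁻ x, φ x ∂(P.langevinRevKernel N T_L T_R s y)
      ≤ ENNReal.ofReal (Real.exp (2 * P.γ * s)) * ∫⁻ y, V y * ∫⁻ x, φ x ∂(P.langevinRevKernel N T_L T_R s y) :=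
        le_mul_of_one_le_left' h1
    _ = ∫⁻ x, ∫⁻ y, Hf (x, y) ∂(P.langevinKernel N T_L T_R s x) := hdual.symm
    _ ≤ _ := hL

/-- A measurable observable dominated by `e^{ϑH}` is integrable for the forward kernels `P_s(x, ·)`
of the pinned chain (`0 < ϑ < 1/max(T_L,T_R)`, CEHR (3.4)). [folklore] -/
theorem pinnedChain_integrable_transitionKernel_of_abs_le_exp (s : ℝ≥0) (x : PhaseSpace N)
    {g : PhaseSpace N → ℝ} (hgm : Measurable g)
    (hgb : ∀ y, |g y| ≤ Real.exp (ϑ * (pinnedChain ω₂ lam β γ).hamiltonian N y)) :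
    Integrable g ((pinnedChain ω₂ lam β γ).transitionKernel N T_L T_R s x) := by
  have h34 := lintegral_exp_mul_hamiltonian_pinnedChainSemigroup_le hω hl hβ hγ hN hTL.le hTR.le hTL hTR
    hϑ hϑ' s x
  have hV : Integrable (fun y => Real.exp (ϑ * (pinnedChain ω₂ lam β γ).hamiltonian N y))
      ((pinnedChain ω₂ lam β γ).transitionKernel N T_L T_R s x) := by
    refine ⟨(Real.continuous_exp.comp (continuous_const.mul
      (pinnedChain_continuous_hamiltonian ω₂ lam β γ N))).aestronglyMeasurable, ?_⟩
    rw [hasFiniteIntegral_iff_ofReal (Eventually.of_forall fun y => (Real.exp_pos _).le)]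
    exact lt_of_le_of_lt h34 ENNReal.ofReal_lt_top
  exact hV.mono' hgm.aestronglyMeasurable (Eventually.of_forall fun y => by
    rw [Real.norm_eq_abs]; exact hgb y)

/-- `|∫ g dP_s(x,·)| ≤ e^{ϑγ(T_L+T_R)s} e^{ϑH(x)}` for measurable `|g| ≤ e^{ϑH}`. [folklore] -/
theorem pinnedChain_abs_integral_transitionKernel_le (s : ℝ≥0) (x : PhaseSpace N)
    {g : PhaseSpace N → ℝ}
    (hgb : ∀ y, |g y| ≤ Real.exp (ϑ * (pinnedChain ω₂ lam β γ).hamiltonian N y)) :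
    |∫ y, g y ∂((pinnedChain ω₂ lam β γ).transitionKernel N T_L T_R s x)| ≤
      Real.exp (ϑ * γ * (T_L + T_R) * s) * Real.exp (ϑ * (pinnedChain ω₂ lam β γ).hamiltonian N x) := by
  set P := pinnedChain ω₂ lam β γ with hPdef
  have hVm : Measurable fun y => Real.exp (ϑ * P.hamiltonian N y) :=
    (Real.continuous_exp.comp (continuous_const.mul (pinnedChain_continuous_hamiltonian ω₂ lam β γ N))).measurable
  have hVi := pinnedChain_integrable_transitionKernel_of_abs_le_exp hω hl hβ hγ hN hTL hTR hϑ hϑ' s x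
    (g := fun y => Real.exp (ϑ * P.hamiltonian N y)) hVm (fun y => by rw [abs_of_pos (Real.exp_pos _)])
  have h34 := lintegral_exp_mul_hamiltonian_pinnedChainSemigroup_le hω hl hβ hγ hN hTL.le hTR.le hTL hTR
    hϑ hϑ' s x
  calc |∫ y, g y ∂(P.transitionKernel N T_L T_R s x)|
      ≤ ∫ y, |g y| ∂(P.transitionKernel N T_L T_R s x) := abs_integral_le_integral_abs
    _ ≤ ∫ y, Real.exp (ϑ * P.hamiltonian N y) ∂(P.transitionKernel N T_L T_R s x) :=
        integral_mono_of_nonneg (Eventually.of_forall fun y => abs_nonneg _) hVi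
          (Eventually.of_forall fun y => hgb y)
    _ = (∫⁻ y, ENNReal.ofReal (Real.exp (ϑ * P.hamiltonian N y)) ∂(P.transitionKernel N T_L T_R s x)).toReal :=
        integral_eq_lintegral_of_nonneg_ae (Eventually.of_forall fun y => (Real.exp_pos _).le)
          hVi.aestronglyMeasurable
    _ ≤ (ENNReal.ofReal (Real.exp (ϑ * γ * (T_L + T_R) * s) * Real.exp (ϑ * P.hamiltonian N x))).toReal :=
        ENNReal.toReal_mono ENNReal.ofReal_ne_top h34
    _ = _ := ENNReal.toReal_ofReal (by positivity)

end Duhamel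

/-- Registered helper sub-goal `helper_nessGibbsDefect` of stmt-AtomisticToContinuum-11976
(= `pinnedChain_lintegral_exp_mul_revKernel_le`, fully quantified, notation-free one-line form). -/
theorem helper_nessGibbsDefect : ∀ (ω₂ lam β γ : ℝ), 0 < ω₂ → 0 ≤ lam → 0 ≤ β → 0 ≤ γ → ∀ (N : ℕ), 0 < N → ∀ (T_L T_R : ℝ), 0 < T_L → 0 < T_R → ∀ (ϑ : ℝ), 0 < ϑ → ϑ < 1 / max T_L T_R → ∀ (s : NNReal), 0 < s → ∀ (φ : Literature.MathematicalPhysics.KineticTheory.HeatConduction.PhaseSpace N → ENNReal), Measurable φ → MeasureTheory.lintegral MeasureTheory.volume (fun y => ENNReal.ofReal (Real.exp (ϑ * (Literature.MathematicalPhysics.KineticTheory.HeatConduction.pinnedChain ω₂ lam β γ).hamiltonian N y)) * MeasureTheory.lintegral ((Literature.MathematicalPhysics.KineticTheory.HeatConduction.pinnedChain ω₂ lam β γ).langevinRevKernel N T_L T_R s y) (fun x => φ x)) ≤ ENNReal.ofReal (Real.exp (ϑ * γ * (T_L + T_R) * (s : ℝ))) * MeasureTheory.lintegral MeasureTheory.volume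 (fun x => φ x * ENNReal.ofReal (Real.exp (ϑ * (Literature.MathematicalPhysics.KineticTheory.HeatConduction.pinnedChain ω₂ lam β γ).hamiltonian N x))) :=
  fun _ _ _ _ hω hl hβ hγ _ hN _ _ hTL hTR _ hϑ hϑ' _ hs _ hφ =>
    pinnedChain_lintegral_exp_mul_revKernel_le hω hl hβ hγ hN hTL hTR hϑ hϑ' hs hφ

end Summit.AtomisticToContinuum.FouriersLaw.Theorems.FixedLengthNoiseContinuity

end
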